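import Mathlib
import Summits.AtomisticToContinuum.Crystallization.Theses.ChessboardParticlePlanes
import Summits.AtomisticToContinuum.Crystallization.Theorems.ChessboardParticlePlanesLjLaminarWindowsCruxOfOneWindow
import Summits.AtomisticToContinuum.Crystallization.Theorems.ChessboardParticlePlanesLjLaminarWindowsLocalNonSpiky
import Summits.AtomisticToContinuum.Crystallization.Theorems.ChessboardParticlePlanesLjLaminarWindowsFarParticle
import Summits.AtomisticToContinuum.Crystallization.Theorems.ChessboardParticlePlanesLjLaminarWindowsSubWindow
import Summits.AtomisticToContinuum.Crystallization.Theorems.ChessboardParticlePlanesLjLaminarWindowsOneWindowOfLaminarityAt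
import Summits.AtomisticToContinuum.Crystallization.Theorems.ChessboardParticlePlanesLjLaminarWindowsResidual
import HarnessLib

/-!
# `LjLaminarWindows` is equivalent to its own laminarity clause — line `Sketch`, skeleton rev. 17/18
(lead c11), crux stmt-AtomisticToContinuum-6711

**Theorem (`LjLaminarWindows_iff_oneWindow`, unconditional).** The crux `LjLaminarWindows` of route
`ChessboardParticlePlanes` — for every sequence of Lennard-Jones ground states and all `η, ε > 0` there is `L₀`
such that for every `L ≥ L₀`, frequently in `N`, SOME particle-centred closed `L`-window is (1) equipped with a
`3/4`-separated height set `T`, (2) `7/10`-separated, (3) `η`-laminar for `T` in a rotated third coordinate, and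
(4) has internal energy `≤ 2(⨅_Q e(Q) + ε)·#window` — is EQUIVALENT to the statement obtained by deleting the
separation clause (2), the energy clause (4) and `ε`: "for every `η > 0` there is `L₀` such that for every
`L ≥ L₀`, frequently in `N`, some particle-centred closed `L`-window is `η`-laminar" (ONE laminar window per
scale).  So the open content of stmt-6711 is exactly, and only, one-window layering of Lennard-Jones ground
states at thicknesses `η < 3/8` (for `η ≥ 3/8` both sides are theorems: `ljLaminarWindows_of_three_eighths_le`).

Proof of `⇐` (`LjLaminarWindows_of_oneWindow`): the registered glue `stub_cruxOfOneWindow` (p135891) fed with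
the three registered geometric stubs of rev. 17, all landed — local non-spikiness `stub_localNonSpiky` (p135965;
from the NSF mass bound and sparse contradiction), far particles `stub_farParticle` (p135977; packing), and
sub-window inheritance `stub_subWindow` (p135999; translate the height set) — and, inside the glue, the landed
`7/10` minimal distance, `23/20` connectivity, window removal, shell bound and path count.  `⇒` is the projection
`oneWindow_of_LjLaminarWindows`.  The old chain is kept: a.e. laminarity (board item stmt-14293) ⇒ rev-16 density
residual (`laminarityAt_of_laminarity`) ⇒ one window (`stub_oneWindow_of_laminarityAt`, p136026) ⇒ crux, packaged
as `oneWindow_of_laminarity`; closing recipe when 14293 is proved: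
`LjLaminarWindows_of_oneWindow (oneWindow_of_laminarity LjLaminarity_holds)` (the same statement as the landed
`LjLaminarWindows_of_laminarity` of …NSF.lean, which stays the one-line recipe).
-/

noncomputable section

open scoped BigOperators
open Filter Topology
open Literature.MathematicalPhysics.StatisticalMechanics
open Summit.AtomisticToContinuum.Crystallization.Theorems.ChargedEnergyGapNegative

namespace Summit.AtomisticToContinuum.Crystallization.Theorems.LjLaminarWindowsSketch

/-- **`LjLaminarWindows` from ONE laminar window per scale.** If along every sequence of Lennard-Jones ground
states, for every `η > 0`, for all large radii `L`, frequently in `N`, some particle `i`, linear isometry `A`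
and `3/4`-separated height set `T` make the closed `L`-ball around `xᵢ` `η`-laminar, then the crux holds: the
glue `stub_cruxOfOneWindow` with the landed stubs `stub_localNonSpiky`, `stub_farParticle`, `stub_subWindow`.
[folklore] -/
theorem LjLaminarWindows_of_oneWindow
    (hOne : ∀ x : (N : ℕ) → (Fin N → EuclideanSpace ℝ (Fin 3)),
      (∀ N, IsGroundState lennardJones (x N)) →
      ∀ η : ℝ, 0 < η → ∃ L₀ : ℝ, ∀ L : ℝ, L₀ ≤ L → ∃ᶠ N in Filter.atTop,
        ∃ (i : Fin N) (A : EuclideanSpace ℝ (Fin 3) →ₗᵢ[ℝ] EuclideanSpace ℝ (Fin 3)) (T : Set ℝ),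
          (∀ t ∈ T, ∀ t' ∈ T, t ≠ t' → (3 : ℝ) / 4 ≤ |t - t'|) ∧
          (∀ j : Fin N, dist (x N j) (x N i) ≤ L → ∃ t ∈ T, |(A (x N j - x N i)) 2 - t| ≤ η)) :
    Summit.AtomisticToContinuum.Crystallization.Theses.ChessboardParticlePlanes.LjLaminarWindows := by
  unfold Summit.AtomisticToContinuum.Crystallization.Theses.ChessboardParticlePlanes.LjLaminarWindows
  exact stub_cruxOfOneWindow stub_localNonSpiky stub_farParticle stub_subWindow hOne

/-- **The crux implies one laminar window per scale** (projection to clauses 1 and 3 at `ε = 1`).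
[folklore] -/
theorem oneWindow_of_LjLaminarWindows
    (h : Summit.AtomisticToContinuum.Crystallization.Theses.ChessboardParticlePlanes.LjLaminarWindows) :
    ∀ x : (N : ℕ) → (Fin N → EuclideanSpace ℝ (Fin 3)),
      (∀ N, IsGroundState lennardJones (x N)) →
      ∀ η : ℝ, 0 < η → ∃ L₀ : ℝ, ∀ L : ℝ, L₀ ≤ L → ∃ᶠ N in Filter.atTop,
        ∃ (i : Fin N) (A : EuclideanSpace ℝ (Fin 3) →ₗᵢ[ℝ] EuclideanSpace ℝ (Fin 3)) (T : Set ℝ),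
          (∀ t ∈ T, ∀ t' ∈ T, t ≠ t' → (3 : ℝ) / 4 ≤ |t - t'|) ∧
          (∀ j : Fin N, dist (x N j) (x N i) ≤ L → ∃ t ∈ T, |(A (x N j - x N i)) 2 - t| ≤ η) := by
  intro x hx η hη
  obtain ⟨L₀, hL₀⟩ := h x hx η 1 hη one_pos
  refine ⟨L₀, fun L hL => (hL₀ L hL).mono ?_⟩
  rintro N ⟨i, A, T, hT, -, hlam, -⟩
  exact ⟨i, A, T, hT, hlam⟩

/-- **`LjLaminarWindows` ↔ one laminar window per scale (unconditional).** The crux of route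
`ChessboardParticlePlanes` (stmt-AtomisticToContinuum-6711) is equivalent to its own laminarity clause: the
`7/10`-separation of the window, its energy bound `≤ 2(⨅_Q e(Q) + ε)·#window` and the quantifier `∀ ε > 0` are
free riders (minimal distance, connectivity, window removal, shell bound, path count, local NSF — all theorems).
[folklore] -/
theorem LjLaminarWindows_iff_oneWindow :
    Summit.AtomisticToContinuum.Crystallization.Theses.ChessboardParticlePlanes.LjLaminarWindows ↔
    (∀ x : (N : ℕ) → (Fin N → EuclideanSpace ℝ (Fin 3)),
      (∀ N, IsGroundState lennardJones (x N)) →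
      ∀ η : ℝ, 0 < η → ∃ L₀ : ℝ, ∀ L : ℝ, L₀ ≤ L → ∃ᶠ N in Filter.atTop,
        ∃ (i : Fin N) (A : EuclideanSpace ℝ (Fin 3) →ₗᵢ[ℝ] EuclideanSpace ℝ (Fin 3)) (T : Set ℝ),
          (∀ t ∈ T, ∀ t' ∈ T, t ≠ t' → (3 : ℝ) / 4 ≤ |t - t'|) ∧
          (∀ j : Fin N, dist (x N j) (x N i) ≤ L → ∃ t ∈ T, |(A (x N j - x N i)) 2 - t| ≤ η)) :=
  ⟨oneWindow_of_LjLaminarWindows, LjLaminarWindows_of_oneWindow⟩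

/-- **One laminar window per scale from a.e. laminarity.** The statement of board item
stmt-AtomisticToContinuum-14293 (`LaminarSixThreeThree.LjLaminarity`) implies the one-window residual:
`laminarityAt_of_laminarity` (…Residual.lean) then `stub_oneWindow_of_laminarityAt` (p136026). [folklore] -/
theorem oneWindow_of_laminarity
    (hLam : ∀ t R : ℝ, 0 < t → 0 < R → ∀ x : (N : ℕ) → (Fin N → EuclideanSpace ℝ (Fin 3)),
      (∀ N, IsGroundState lennardJones (x N)) →
      Filter.Tendsto (fun N : ℕ => (Nat.card {i : Fin N // ¬ (∃ n : EuclideanSpace ℝ (Fin 3),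
        ‖n‖ = 1 ∧ ∃ c : ℤ → ℝ, (∀ k : ℤ, c k + 3 / 4 ≤ c (k + 1)) ∧ ∀ j : Fin N,
          dist (x N j) (x N i) ≤ R → ∃ k : ℤ, |inner ℝ (x N j - x N i) n - c k| ≤ t)} : ℝ) / N)
        Filter.atTop (nhds 0)) :
    ∀ x : (N : ℕ) → (Fin N → EuclideanSpace ℝ (Fin 3)),
      (∀ N, IsGroundState lennardJones (x N)) →
      ∀ η : ℝ, 0 < η → ∃ L₀ : ℝ, ∀ L : ℝ, L₀ ≤ L → ∃ᶠ N in Filter.atTop,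
        ∃ (i : Fin N) (A : EuclideanSpace ℝ (Fin 3) →ₗᵢ[ℝ] EuclideanSpace ℝ (Fin 3)) (T : Set ℝ),
          (∀ t ∈ T, ∀ t' ∈ T, t ≠ t' → (3 : ℝ) / 4 ≤ |t - t'|) ∧
          (∀ j : Fin N, dist (x N j) (x N i) ≤ L → ∃ t ∈ T, |(A (x N j - x N i)) 2 - t| ≤ η) :=
  stub_oneWindow_of_laminarityAt (laminarityAt_of_laminarity hLam)

end Summit.AtomisticToContinuum.Crystallization.Theorems.LjLaminarWindowsSketch

end
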